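import Mathlib
import HarnessLib
import Summits.Langlands.Langlands.Statement
import Summits.Langlands.Langlands.Theorems.SkinnerWilesDefectOneEisensteinProModularSeedQuadraticBaseChangeTwistNonDihedral
import Summits.Langlands.Langlands.Theorems.SkinnerWilesDefectOneEisensteinProModularSeedQuadraticBaseChangeTwistCharacter
import Literature.NumberTheory.Automorphic.BaseChangeCyclicCuspidal
import Literature.NumberTheory.Automorphic.AutomorphicTwistWeightOne
import Literature.NumberTheory.Automorphic.ReciprocityGLn
import Literature.NumberTheory.Automorphic.TunnellOctahedralGlobal
import Literature.NumberTheory.GaloisRepresentations.GaloisRep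
import Literature.NumberTheory.Automorphic.QuadraticBaseChangeFrobCompatible

/-!
# Stub `stub_quadraticBaseChangeTwist` of the line `descend-raise-basechange`
# (crux `EisensteinProModularSeed`, stmt-Langlands-12920): quadratic base change of `π` to `F`,
# twisted by the finite-order character `ν`

`F` imaginary quadratic, `π` cuspidal on `GL₂(𝔸_ℚ)` with a regular L-algebraic infinity type `T`,
`ρ' : Γ_ℚ → GL₂(ℚ̄_p)` Satake–Frobenius compatible with `π` almost everywhere, `ν : Γ_F → ℚ̄_pˣ`
continuous of finite order, `r = ν ⊗ ρ'|_{Γ_F}` irreducible, `S ⊇ {v ∣ p}` finite with `r` and `ν`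
unramified off `S`.  CONCLUSION: a cuspidal `πF` on `GL₂(𝔸_F)` with the regular L-algebraic infinity
type `T^F` and `SatakeFrobCompatibleAt ι πF r v` at EVERY `v ∉ S`.

Proof (`stub_quadraticBaseChangeTwist`), CONDITIONAL on three named facts taken as hypotheses:
1. `baseChange_cyclic_cuspidal` (tree; Arthur–Clozel Ch. 3 Thm. 4.2 (a), datum model): a cuspidal
   weak base-change lift `Π` of `π` exists once `π` has, at some inert place, a Satake parameter
   `α` with `-α ≠ α` — which holds because `ρ'|_{Γ_F}` is irreducible (`r` is): the proved
   `exists_inert_hasSatakeParamAt_map_ne` (auxiliary file `…NonDihedral`: Chebotarev +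
   Brauer–Nesbitt + Schur);
2. `ArthurClozel1989_strongLifting_archimedean` (tree; Arthur–Clozel Thm. 5.1, Ch. 1 §7): `Π` has
   infinity type `T.baseChange F`, again regular and L-algebraic;
3. `Langlands1980_quadraticBaseChange_frobCompatible` (NEW, stated below; Langlands 1980 +
   Arthur–Clozel Thm. 5.1 + Carayol 1986 Thm. (A), §12.2): `Π` is Satake–Frobenius compatible with
   `ρ'|_{Γ_F}` at EVERY `w ∤ p` where the latter is unramified — the local–global content beyond
   weak base change, needed at the finitely many `v ∉ S` above ramified primes of `π`.
Then `πF := Π ⊗ (χ ∘ det)` (`CuspidalAutomorphicRepData.twist`, proved in the tree) for the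
finite-order Hecke character `χ` of `ν` given by global class field theory
(`exists_heckeCharacter_of_finiteOrder`, auxiliary file `…Character`, from
`artinReciprocity_character_holds`); twisting preserves the infinity type
(`HasArchParameter.twist`), and at `v ∉ S` — where `ν`, hence `χ`, is unramified and `ρ'|_{Γ_F}`
is unramified — the Satake parameter of `πF` is `χ(ϖ_v) · t_{Π,v}` while `r(Frob_v) = ν(Frob_v)
ρ'(Frob_v)` with `ν(Frob_v) = ι⁻¹(χ(ϖ_v))⁻¹` (`satakeFrobCompatibleAt_twist`).

The registered signature of S4 lacks the hypothesis "`ν` unramified off `S`" (supplied by the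
neighbour S3, whose `ν` is the Teichmüller lift of `χ̄_a` and whose `S` contains the ramified places
of `χ̄_a`); without it the twist may absorb ramification of `ρ'|_{Γ_F}` at places `v ∉ S`, which
only a local–global statement for `BC(π) ⊗ χ` at ramified `χ` could address.  The theorem below is
the registered statement with that hypothesis inserted and the three facts prepended.
-/

set_option linter.dupNamespace false -- project-wide option (lakefile weak.linter.dupNamespace); `Summit.Langlands.Langlands` is the mandated namespace

noncomputable section

open scoped MatrixGroups Matrix NumberField Polynomial Classical
open NumberField IsDedekindDomain Field Polynomial Filter
open Literature.NumberTheory.Automorphic Literature.NumberTheory.GaloisRepresentations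

namespace Summit.Langlands.Langlands.Theorems.SkinnerWilesDefectOne.EisensteinProModularSeed

/-! ## The named fact: Langlands' quadratic base change, Galois-compatible at every place off `p` -/

/-- `ρ'|_{Γ_F}` is unramified at `v` when `r = ν ⊗ ρ'|_{Γ_F}` is and `ν` kills the inertia at `v`.
[folklore] -/
theorem isUnramifiedAt_restrictField_of_smul {F : Type} [Field F] [NumberField F] {p : ℕ}
    [Fact p.Prime] (ρ' : FramedGaloisRep ℚ (PadicAlgCl p) 2)
    (ν : absoluteGaloisGroup F →ₜ* (PadicAlgCl p)ˣ) (r : FramedGaloisRep F (PadicAlgCl p) 2)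
    (hrν : ∀ σ, (r σ).val = ((ν σ : (PadicAlgCl p)ˣ) : PadicAlgCl p) • (ρ' (absGaloisRestrict ℚ F σ)).val)
    {v : HeightOneSpectrum (𝓞 F)} (hr : r.IsUnramifiedAt v)
    (hν : ∀ 𝔓 ∈ v.primesAbove, ∀ σ ∈ 𝔓.inertia (absoluteGaloisGroup F), ν σ = 1) :
    (ρ'.restrictField F).IsUnramifiedAt v := by
  intro 𝔓 h𝔓 σ hσ
  have h1 := hrν σ
  rw [hr 𝔓 h𝔓 σ hσ, hν 𝔓 h𝔓 σ hσ, Units.val_one, Units.val_one, one_smul] at h1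
  rw [FramedGaloisRep.restrictField_apply]
  exact (Units.val_eq_one.mp h1.symm)

/-- **Stub S4 `stub_quadraticBaseChangeTwist`, conditional form** (facts 1–3 of the module docstring
prepended, in this order; the registered statement with the hypothesis "`ν` is unramified off `S`"
inserted after "`r` is unramified off `S`").  Langlands' quadratic base change of `π` to `F`
(cuspidal by the non-dihedral lemma, regular L-algebraic of infinity type `T^F`), twisted by the
Hecke character of `ν` (global class field theory), is Satake–Frobenius compatible with
`r = ν ⊗ ρ'|_{Γ_F}` at every `v ∉ S`.
[cite: LanglandsBaseChange1980, global base change lifting for GL(2)]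
[cite: ArthurClozelAMS120, Ch. 3 Thm. 4.2 (a) and Thm. 5.1] [cite: CarayolASENS1986, Thm. (A) and §12.2] -/
theorem stub_quadraticBaseChangeTwist :
    Literature.NumberTheory.Automorphic.baseChange_cyclic_cuspidal →
    Literature.NumberTheory.Automorphic.ArthurClozel1989_strongLifting_archimedean →
    Literature.NumberTheory.Automorphic.Langlands1980_quadraticBaseChange_frobCompatible →
    ∀ (F : Type) [Field F] [NumberField F], NumberField.IsTotallyComplex F → Module.finrank ℚ F = 2 →
      ∀ (p : ℕ) [Fact p.Prime] (hcptQ : Literature.NumberTheory.Automorphic.isCompact_glFiniteIntegralLevel 2 ℚ) (ι : PadicAlgCl p ≃+* ℂ)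
        (π : Literature.NumberTheory.Automorphic.CuspidalAutomorphicRepData 2 ℚ hcptQ) (T : Literature.NumberTheory.Automorphic.InfinityType ℚ 2),
      π.1.HasInfinityType T → T.IsLAlgebraic → T.IsRegular →
      ∀ (ρ' : Literature.NumberTheory.GaloisRepresentations.FramedGaloisRep ℚ (PadicAlgCl p) 2),
      (∀ᶠ w in Filter.cofinite, Summit.Langlands.SatakeFrobCompatibleAt ι π.1 ρ' w) →
      ∀ (ν : Field.absoluteGaloisGroup F →ₜ* (PadicAlgCl p)ˣ), (∃ n : ℕ, 0 < n ∧ ∀ σ, ν σ ^ n = 1) →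
      ∀ (r : Literature.NumberTheory.GaloisRepresentations.FramedGaloisRep F (PadicAlgCl p) 2),
      (∀ σ, (r σ).val = ((ν σ : (PadicAlgCl p)ˣ) : PadicAlgCl p) • (ρ' (Literature.NumberTheory.GaloisRepresentations.absGaloisRestrict ℚ F σ)).val) →
      r.toGaloisRep.IsIrreducible →
      ∀ (S : Set (IsDedekindDomain.HeightOneSpectrum (NumberField.RingOfIntegers F))), S.Finite →
      (∀ v : IsDedekindDomain.HeightOneSpectrum (NumberField.RingOfIntegers F), (p : NumberField.RingOfIntegers F) ∈ v.asIdeal → v ∈ S) →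
      (∀ v ∉ S, r.IsUnramifiedAt v) →
      (∀ v ∉ S, ∀ 𝔓 ∈ v.primesAbove, ∀ σ ∈ 𝔓.inertia (Field.absoluteGaloisGroup F), ν σ = 1) →
      ∀ hcptF : Literature.NumberTheory.Automorphic.isCompact_glFiniteIntegralLevel 2 F,
        ∃ (πF : Literature.NumberTheory.Automorphic.CuspidalAutomorphicRepData 2 F hcptF) (T' : Literature.NumberTheory.Automorphic.InfinityType F 2),
          πF.1.HasInfinityType T' ∧ T'.IsLAlgebraic ∧ T'.IsRegular ∧
          ∀ v ∉ S, Summit.Langlands.SatakeFrobCompatibleAt ι πF.1 r v := by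
  intro h₁ h₂ h₃ F _ _ _ hdeg p _ hcptQ ι π T hT hTL hTR ρ' hcompat ν hν r hrν hrirr S _ hSp hSunr hνS
    hcptF
  -- `F/ℚ` is quadratic, hence cyclic Galois of prime degree
  haveI : Algebra.IsQuadraticExtension ℚ F := ⟨hdeg⟩
  haveI : IsGalois ℚ F := inferInstance
  have hprime : (Module.finrank ℚ F).Prime := hdeg ▸ Nat.prime_two
  -- (1) irreducibility of `ρ'|_{Γ_F}` and of `ρ'`
  have hρ'F : (ρ'.restrictField F).toGaloisRep.IsIrreducible :=
    isIrreducible_of_coe_eq_smul r (ρ'.restrictField F) id (fun σ => ((ν σ : (PadicAlgCl p)ˣ) : PadicAlgCl p))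
      (fun σ => by rw [id, FramedGaloisRep.restrictField_apply]; exact hrν σ) hrirr
  have hρ'irr : ρ'.toGaloisRep.IsIrreducible :=
    isIrreducible_of_coe_eq_smul r ρ' (absGaloisRestrict ℚ F) (fun σ => ((ν σ : (PadicAlgCl p)ˣ) : PadicAlgCl p))
      hrν hrirr
  -- (2) the cuspidal base change `P` of `π` (fact 1 + the non-dihedral lemma), its infinity type (fact 2)
  have hne := exists_inert_hasSatakeParamAt_map_ne F hdeg ι π.1 ρ' hcompat hρ'F
  obtain ⟨P, hBC⟩ := h₁ 2 ℚ F hprime hcptQ π hne hcptF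
  have hPT : P.1.HasInfinityType (T.baseChange F) :=
    h₂.hasInfinityType_baseChange inferInstance hprime hBC hT
  -- (3) the Hecke character `χ` of `ν` and the twist `πF = P ⊗ (χ ∘ det)`
  obtain ⟨χ, hχ, hχν⟩ := exists_heckeCharacter_of_finiteOrder ι ν hν
  refine ⟨P.twist χ hχ, T.baseChange F, ⟨hPT.1, ?_⟩, hTL.baseChange, hTR.baseChange, fun v hv => ?_⟩
  · rw [CuspidalAutomorphicRepData.twist_val]
    exact AutomorphicRepData.HasArchParameter.twist P.1 χ hχ hPT.2
  -- (4) compatibility at `v ∉ S`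
  have hvp : (p : 𝓞 F) ∉ v.asIdeal := fun h => hv (hSp v h)
  have hρ'v : (ρ'.restrictField F).IsUnramifiedAt v :=
    isUnramifiedAt_restrictField_of_smul ρ' ν r hrν (hSunr v hv) (hνS v hv)
  obtain ⟨hχv, hνv⟩ := hχν v (hνS v hv)
  have hc : Summit.Langlands.SatakeFrobCompatibleAt ι P.1 (ρ'.restrictField F) v :=
    h₃ F hdeg p ι hcptQ hcptF π T hT hTL hTR ρ' hρ'irr hcompat P hBC v hvp hρ'v
  rw [CuspidalAutomorphicRepData.twist_val]
  exact satakeFrobCompatibleAt_twist ι P.1 (ρ'.restrictField F) r hχ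
    (fun σ => ((ν σ : (PadicAlgCl p)ˣ) : PadicAlgCl p))
    (fun σ => by rw [FramedGaloisRep.restrictField_apply]; exact hrν σ) hχv hνv (hSunr v hv) hc

end Summit.Langlands.Langlands.Theorems.SkinnerWilesDefectOne.EisensteinProModularSeed

end
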